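import Literature.AnabelianGeometry.SemiGraphs.WitnessIwahoriSeqLoop
import Literature.AnabelianGeometry.SemiGraphs.CoveringGraphGaloisCountableNegative
import HarnessLib

/-!
# Galois-countability — hence the hypotheses of Prop. 3.6 / Thm. 3.7 — is NOT hereditary along infinite
# tempered coverings of a base satisfying ALL of Thm. 3.7's hypotheses: the coherence gap is sharp

abc-iut cell, layer L3, route T · T7d∞-NEG37 (seat abc-iut-L3-t5; L3-lead β30).  FRONTIER label:
erratum-grade TIGHTNESS datum for the cell's own heredity theorems of route T — `CoveringGraphCoherent`
({Prop 3.6 hypotheses ∧ COHERENT} is hereditary along connected tempered coverings of ANY degree),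
`CoveringGraphFiniteDegree` (hereditary in FINITE degree over any base), `CoveringGraphGaloisCountableNegative`
(fails over the incoherent bouquet `𝒢₀`, which however is not a Prop-3.6 object).  It retypes and changes NO
statement of record and lies outside the [IUTchIII] Cor. 3.12 cone.  Mochizuki, *Semi-graphs of
anabelioids*, Publ. RIMS **42** (2006), Def. 2.3 (iii) p. 25, §3 Def. 3.5 (i)–(ii) p. 37 (the covering
semi-graph `G_S → G` of `S ∈ B^cov(G)`, `CovObj.coveringGraph`; tempered coverings), Rmk. 3.5.1 p. 37,
Prop. 3.6 p. 38, Thm. 3.7 p. 40 [cite: MochizukiSemiAnbd2006, Def 3.5(i) p.37]; Galois-countability [IUTchI]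
Rmk. 2.5.3 (i) (T2) p. 52 [cite: Mochizuki2012, IUTchI Rmk 2.5.3 (i) (T2), p. 52].

Over the Thm-3.7-grade, NON-coherent loop `𝒢_ω = seqLoop p` of `WitnessIwahoriSeqLoop` (vertex group
`P_ω = ℤ_p^ℕ ⋊ (1 + pℤ_p)`, edge group `U`, estranged branches `T_0`, `T_{δ_0}`):
* `seqUnwinding` (`S_ω`): the `ℤ`-unwinding of the loop (fibres `ℤ`, trivial actions, gluings `n ↦ n`,
  `n ↦ n + 1`) — tempered (`seqUnwinding_isTempered`) and connected (`isConnectedObj_seqUnwinding`; its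
  covering graph `G_{S_ω}` is the bi-infinite chain with all vertex groups `P_ω`, all edge groups `U`);
* `diagObj` — the diagonal degree-`p` covering of `G_{S_ω}`: over the vertex `v'` the set `ℤ/p` with `P_ω`
  acting through the character `χ_{m(v')+1}` (`(a, s) ↦ a_{m+1} mod p`), over the edges `ℤ/p` with trivial
  action and IDENTITY gluings — legitimate because `χ_{m+1}` kills BOTH branch classes `T_0`, `T_{δ_0}` and
  all their conjugates (`χ_coveringGraph_brHom`; this is exactly what fails for a product-type vertex group);
* **`not_isGaloisCountable_coveringGraph_seqUnwinding`** — `G_{S_ω}` is NOT Galois-countable: against any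
  countable family `F_i` of finite objects, choose at the `i`-th vertex a point `z_i` of `F_i` and a basis
  element `δ_m`, `m ≥ 1`, inside its open stabiliser; the diagonal covering reading the coordinate `m` there
  is split by no `F_i`;
* records `exists_thm37Hypotheses_not_isGaloisCountable_coveringGraph`,
  **`not_forall_thm37Hypotheses_isGaloisCountable_coveringGraph`** and
  **`not_forall_thm37Hypotheses_prop36Hypotheses_coveringGraph`**: with ALL of Thm. 3.7's hypotheses on the
  base kept but coherence absent, (T2) — and therefore the bundle `Prop36Hypotheses` itself — does NOT pass
  to the covering graph of a connected tempered covering of infinite degree.  So "coherent" in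
  `CovObj.isGaloisCountable_coveringGraph_of_isCoherent` is NECESSARY, not an artefact of the proof.

Honest framing: a tightness datum (print's Prop. 3.6 (v) assumes coherence; [IUTchI] works with finite,
coherent graphs, where heredity holds by `CoveringGraphCoherent`); nothing here bears on Cor. 3.12.
-/

noncomputable section

open CategoryTheory Topology

namespace Literature.AnabelianGeometry.SemiGraphs

open Literature.AlgebraicGeometry.Frobenioids (IsConnectedObj)
open Literature.AlgebraicGeometry.Frobenioids.QuasiTemperoid.BTempConnected (ρ_one_apply)
open ProfiniteSemiGraph
open ProfiniteSemiGraph.IncoherentBouquet (trivialObj charObj charObj_ρ loop out_cl_trivialObj)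

namespace IwSeqWitness

variable (p : ℕ) [Fact p.Prime]

/-! ### 1. The `ℤ`-unwinding `S_ω` of `𝒢_ω`: a connected tempered covering of infinite degree -/

/-- **The `ℤ`-unwinding `S_ω ∈ B^cov(𝒢_ω)`**: fibre `ℤ` with TRIVIAL actions over the vertex and the edge;
the branch `false` glues by `n ↦ n`, the branch `true` by `n ↦ n + 1`.
[cite: MochizukiSemiAnbd2006, Rmk 3.5.1 p.37] -/
def seqUnwinding : CovObj (seqLoop p) where
  SV _ := trivialObj (IwSeq p) ℤ
  SE _ := trivialObj (IwU p) ℤ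
  glue b _ _ := match b with
    | false => BTemp.isoOfEquiv (Equiv.refl ℤ) fun _ _ => rfl
    | true => BTemp.isoOfEquiv (show ℤ ≃ ℤ from Equiv.addRight (1 : ℤ)) fun _ _ => rfl

/-- The one-point covering of `𝒢_ω`. [cite: MochizukiSemiAnbd2006, §3 p.36] -/
def seqPointCov : CovObj (seqLoop p) where
  SV _ := trivialObj (IwSeq p) PUnit
  SE _ := trivialObj (IwU p) PUnit
  glue _ _ _ := BTemp.isoOfEquiv (Equiv.refl _) fun _ _ => rfl

/-- **`S_ω` is tempered**: locally trivial, hence split at every point by the one-point covering.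
[cite: MochizukiSemiAnbd2006, Def 3.5(ii) p.37] -/
theorem seqUnwinding_isTempered : (seqUnwinding p).IsTempered := fun _ =>
  ⟨seqPointCov p, ⟨fun _ => inferInstanceAs (Finite PUnit), fun _ => inferInstanceAs (Finite PUnit)⟩,
    ⟨fun _ => ⟨PUnit.unit⟩, fun _ => ⟨PUnit.unit⟩⟩, fun q _ => by
      rcases q with ⟨v, s⟩ | ⟨e, s⟩
      · intro _ _ _; rfl
      · intro _ _ _; rfl⟩

/-- The vertex of `G_{S_ω}` labelled by `n ∈ ℤ`. [cite: MochizukiSemiAnbd2006, Def 3.5(i) p.37] -/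
def vtx (n : ℤ) : (seqUnwinding p).coveringGraph.graph.Vertex := ⟨(), BTemp.cl (trivialObj (IwSeq p) ℤ) n⟩

/-- Every vertex of `G_{S_ω}` is some `vtx n`. [cite: MochizukiSemiAnbd2006, Def 3.5(i) p.37] -/
theorem exists_vtx_eq (v' : (seqUnwinding p).coveringGraph.graph.Vertex) : ∃ n : ℤ, vtx p n = v' := by
  obtain ⟨⟨⟩, ω⟩ := v'
  obtain ⟨n, rfl⟩ := Quot.exists_rep ω
  exact ⟨n, rfl⟩

/-- The chosen base point of `vtx n` is `n`. [cite: MochizukiSemiAnbd2006, Def 3.5(i) p.37] -/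
theorem out_vtx (n : ℤ) : Quot.out (vtx p n).2 = n := out_cl_trivialObj (IwSeq p) ℤ n

/-- In `G_{S_ω}`, the branch `(false, n)` abuts to `vtx n`. [cite: MochizukiSemiAnbd2006, Def 3.5(i) p.37] -/
theorem coveringGraph_abuts_false (n : ℤ) :
    (seqUnwinding p).coveringGraph.graph.abuts ⟨false, BTemp.cl (trivialObj (IwU p) ℤ) n⟩ =
      some (vtx p n) := rfl

/-- In `G_{S_ω}`, the branch `(true, n)` abuts to `vtx (n + 1)`. [cite: MochizukiSemiAnbd2006, Def 3.5(i) p.37] -/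
theorem coveringGraph_abuts_true (n : ℤ) :
    (seqUnwinding p).coveringGraph.graph.abuts ⟨true, BTemp.cl (trivialObj (IwU p) ℤ) n⟩ =
      some (vtx p (n + 1)) := rfl

/-- One step of the chain: `vtx n` and `vtx (n + 1)` are joined in the subdivision of `G_{S_ω}`.
[cite: MochizukiSemiAnbd2006, §1 p.11] -/
theorem reachable_vtx_succ (n : ℤ) :
    (seqUnwinding p).coveringGraph.graph.subdivision.Reachable (Sum.inl (vtx p n))
      (Sum.inl (vtx p (n + 1))) := by
  let G := (seqUnwinding p).coveringGraph.graph
  let ω : BTemp.Orbits (trivialObj (IwU p) ℤ) := BTemp.cl (trivialObj (IwU p) ℤ) n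
  have h1 : G.subdivision.Adj (Sum.inr (Sum.inr ⟨false, ω⟩)) (Sum.inl (vtx p n)) :=
    G.subdivision_adj_of_nodeRel (SemiGraph.NodeRel.branch_vertex (G := G) ⟨false, ω⟩ (vtx p n)
      (coveringGraph_abuts_false p n))
  have h2 : G.subdivision.Adj (Sum.inr (Sum.inl ⟨(), ω⟩)) (Sum.inr (Sum.inr ⟨false, ω⟩)) :=
    G.subdivision_adj_of_nodeRel (SemiGraph.NodeRel.edge_branch (G := G) ⟨false, ω⟩)
  have h3 : G.subdivision.Adj (Sum.inr (Sum.inl ⟨(), ω⟩)) (Sum.inr (Sum.inr ⟨true, ω⟩)) :=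
    G.subdivision_adj_of_nodeRel (SemiGraph.NodeRel.edge_branch (G := G) ⟨true, ω⟩)
  have h4 : G.subdivision.Adj (Sum.inr (Sum.inr ⟨true, ω⟩)) (Sum.inl (vtx p (n + 1))) :=
    G.subdivision_adj_of_nodeRel (SemiGraph.NodeRel.branch_vertex (G := G) ⟨true, ω⟩ (vtx p (n + 1))
      (coveringGraph_abuts_true p n))
  exact ((h1.symm.reachable.trans h2.symm.reachable).trans h3.reachable).trans h4.reachable

/-- Every vertex of the chain is reachable from `vtx 0`. [cite: MochizukiSemiAnbd2006, §1 p.11] -/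
theorem reachable_vtx (n : ℤ) :
    (seqUnwinding p).coveringGraph.graph.subdivision.Reachable (Sum.inl (vtx p 0)) (Sum.inl (vtx p n)) := by
  induction n using Int.induction_on with
  | zero => exact SimpleGraph.Reachable.refl _
  | succ k ih => exact ih.trans (reachable_vtx_succ p k)
  | pred k ih =>
    have h := reachable_vtx_succ p (-(k : ℤ) - 1)
    rw [show (-(k : ℤ) - 1 + 1) = -k by ring] at h
    exact ih.trans h.symm

/-- Every node of the subdivision of `G_{S_ω}` is reachable from `vtx 0`. [cite: MochizukiSemiAnbd2006, §1 p.11] -/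
theorem reachable_node (x : (seqUnwinding p).coveringGraph.graph.Node) :
    (seqUnwinding p).coveringGraph.graph.subdivision.Reachable (Sum.inl (vtx p 0)) x := by
  let G := (seqUnwinding p).coveringGraph.graph
  have hbr : ∀ (b : Bool) (n : ℤ), G.subdivision.Reachable (Sum.inl (vtx p 0))
      (Sum.inr (Sum.inr ⟨b, BTemp.cl (trivialObj (IwU p) ℤ) n⟩)) := by
    intro b n
    cases b
    · exact (reachable_vtx p _).trans
        (G.subdivision_adj_of_nodeRel (SemiGraph.NodeRel.branch_vertex (G := G) ⟨false, _⟩ _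
          (coveringGraph_abuts_false p n))).symm.reachable
    · exact (reachable_vtx p _).trans
        (G.subdivision_adj_of_nodeRel (SemiGraph.NodeRel.branch_vertex (G := G) ⟨true, _⟩ _
          (coveringGraph_abuts_true p n))).symm.reachable
  rcases x with v' | ⟨⟨⟩, ω⟩ | ⟨b, ω⟩
  · obtain ⟨n, rfl⟩ := exists_vtx_eq p v'
    exact reachable_vtx p n
  · obtain ⟨n, rfl⟩ := Quot.exists_rep ω
    exact (hbr false n).trans
      (G.subdivision_adj_of_nodeRel (SemiGraph.NodeRel.edge_branch (G := G) ⟨false, _⟩)).symm.reachable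
  · obtain ⟨n, rfl⟩ := Quot.exists_rep ω
    exact hbr b n

/-- **`G_{S_ω}` is connected** (the bi-infinite chain). [cite: MochizukiSemiAnbd2006, §1 p.11] -/
theorem isConnected_coveringGraph_seqUnwinding : (seqUnwinding p).coveringGraph.IsConnected := by
  haveI : Nonempty (seqUnwinding p).coveringGraph.graph.Node := ⟨Sum.inl (vtx p 0)⟩
  exact ⟨⟨fun x y => (reachable_node p x).symm.trans (reachable_node p y)⟩⟩

/-- `G_{S_ω}` has a vertex. [cite: MochizukiSemiAnbd2006, Def 3.5(i) p.37] -/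
theorem hasVertex_coveringGraph_seqUnwinding : (seqUnwinding p).coveringGraph.HasVertex := ⟨vtx p 0⟩

/-- **`S_ω` is a connected object of `B^temp(𝒢_ω)`.** [cite: MochizukiSemiAnbd2006, Def 3.5(ii) p.37] -/
theorem isConnectedObj_seqUnwinding :
    IsConnectedObj (⟨seqUnwinding p, seqUnwinding_isTempered p⟩ : BTempCat (seqLoop p)) :=
  (seqUnwinding p).isConnectedObj_of_isConnected_coveringGraph (seqUnwinding_isTempered p)
    (isConnected_coveringGraph_seqUnwinding p) (hasVertex_coveringGraph_seqUnwinding p)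

/-- `S_ω` has an infinite fibre (it is a covering of infinite degree, not a finite object).
[cite: MochizukiSemiAnbd2006, §3 p.37] -/
theorem seqUnwinding_not_isFinite : ¬ (seqUnwinding p).IsFinite := fun h => by
  haveI : Finite ℤ := h.finite_V ()
  exact not_finite ℤ

/-! ### 2. The diagonal finite étale covering of `G_{S_ω}` and the failure of (T2) -/

/-- The vertex groups of `G_{S_ω}` are (the stabilisers, i.e.) all of `P_ω`. [cite: MochizukiSemiAnbd2006, Def 3.5(i) p.37] -/
theorem mem_Gv (v' : (seqUnwinding p).coveringGraph.graph.Vertex) (k : IwSeq p) :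
    k ∈ BTemp.stab ((seqUnwinding p).SV v'.1) (Quot.out v'.2) := rfl

/-- The characters `χ_m` of `P_ω` are continuous (open kernel, discrete target).
[cite: MochizukiSemiAnbd2006, Def 2.3(iii) p.25] -/
theorem continuous_χ (m : ℕ) : Continuous (IwSeq.χ (p := p) m) := by
  refine continuous_of_continuousAt_one _ ?_
  rw [ContinuousAt, map_one]
  intro U hU
  have hker : ((IwSeq.χ (p := p) m).ker : Set (IwSeq p)) ∈ 𝓝 (1 : IwSeq p) :=
    (IwSeq.isOpen_ker_χ m).mem_nhds (by simp)
  exact Filter.mem_map.2 (Filter.mem_of_superset hker fun x hx => by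
    simp only [Set.mem_preimage, SetLike.mem_coe, MonoidHom.mem_ker] at hx ⊢
    rw [hx]; exact mem_of_mem_nhds hU)

/-- The character `χ_m` restricted to a vertex group of `G_{S_ω}`. [cite: MochizukiSemiAnbd2006, Def 3.5(i) p.37] -/
def vChar (v' : (seqUnwinding p).coveringGraph.graph.Vertex) (m : ℕ) :
    (seqUnwinding p).coveringGraph.Gv v' →* Multiplicative (ZMod p) :=
  (IwSeq.χ m).comp (Subgroup.subtype _)

/-- The restricted characters are continuous. [cite: MochizukiSemiAnbd2006, Def 3.5(i) p.37] -/
theorem continuous_vChar (v' : (seqUnwinding p).coveringGraph.graph.Vertex) (m : ℕ) :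
    Continuous (vChar p v' m) :=
  (continuous_χ p m).comp continuous_subtype_val

/-- **The key compatibility**: for `m ≠ 0`, `χ_m` kills every branch homomorphism of `G_{S_ω}` — these are
conjugates `g · b_c(·) · g⁻¹` of the branch maps of `𝒢_ω`, whose images `T_0`, `T_{δ_0}` have `m`-th
translation coordinate `0`, and `χ_m` is conjugation-invariant. [cite: MochizukiSemiAnbd2006, Def 3.5(i) p.37] -/
theorem χ_coveringGraph_brHom (b' : (seqUnwinding p).coveringGraph.graph.Branch)
    (v' : (seqUnwinding p).coveringGraph.graph.Vertex) (h' : (seqUnwinding p).coveringGraph.graph.abuts b' = some v')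
    (g : (seqUnwinding p).coveringGraph.Ge ((seqUnwinding p).coveringGraph.graph.edgeOf b')) {m : ℕ}
    (hm : m ≠ 0) : IwSeq.χ m ((seqUnwinding p).coveringGraph.brHom b' v' h' g).1 = 1 := by
  change IwSeq.χ m ((seqUnwinding p).conjugator h' * IwSeq.bHomSeq (cvec p b'.1) g.1 *
    ((seqUnwinding p).conjugator h')⁻¹) = 1
  rw [IwSeq.χ_conj]
  exact IwSeq.χ_eq_one_of_mem_range_bHomSeq (cvec_of_ne_zero p b'.1 hm) ⟨g.1, rfl⟩

/-- **The diagonal covering.** For an assignment `m'` of a coordinate to every vertex of `G_{S_ω}`, the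
finite object `H_{m'}` of `B^cov(G_{S_ω})` of degree `p`: over the vertex `v'` the set `ℤ/p` with `P_ω`
acting through `χ_{m'(v')+1}`, over the edges `ℤ/p` with trivial action, identity gluings.
[cite: MochizukiSemiAnbd2006, Def 3.5(i) p.37] -/
def diagObj (m' : (seqUnwinding p).coveringGraph.graph.Vertex → ℕ) :
    CovObj (seqUnwinding p).coveringGraph where
  SV v' := charObj (vChar p v' (m' v' + 1)) (continuous_vChar p v' (m' v' + 1))
  SE e' := trivialObj _ (Multiplicative (ZMod p))
  glue b' v' h' := BTemp.isoOfEquiv (Equiv.refl (Multiplicative (ZMod p))) fun g (x : Multiplicative (ZMod p)) => by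
    change x = (charObj (vChar p v' (m' v' + 1)) (continuous_vChar p v' (m' v' + 1))).obj.ρ
      ((seqUnwinding p).coveringGraph.brHom b' v' h' g) x
    rw [charObj_ρ]
    change x = IwSeq.χ (m' v' + 1) ((seqUnwinding p).coveringGraph.brHom b' v' h' g).1 * x
    rw [χ_coveringGraph_brHom p b' v' h' g (Nat.succ_ne_zero _), one_mul]

/-- The diagonal covering is finite. [cite: MochizukiSemiAnbd2006, Def 3.5(i) p.37] -/
theorem diagObj_isFinite (m' : (seqUnwinding p).coveringGraph.graph.Vertex → ℕ) : (diagObj p m').IsFinite :=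
  ⟨fun _ => inferInstanceAs (Finite (Multiplicative (ZMod p))),
    fun _ => inferInstanceAs (Finite (Multiplicative (ZMod p)))⟩

/-- The action on the vertex fibres of the diagonal covering, in closed form.
[cite: MochizukiSemiAnbd2006, Def 3.5(i) p.37] -/
theorem diagObj_ρ (m' : (seqUnwinding p).coveringGraph.graph.Vertex → ℕ)
    (v' : (seqUnwinding p).coveringGraph.graph.Vertex) (k : IwSeq p)
    (hk : k ∈ BTemp.stab ((seqUnwinding p).SV v'.1) (Quot.out v'.2)) (x : Multiplicative (ZMod p)) :
    ((diagObj p m').SV v').obj.ρ ⟨k, hk⟩ x = IwSeq.χ (m' v' + 1) k * x :=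
  charObj_ρ (vChar p v' (m' v' + 1)) (continuous_vChar p v' (m' v' + 1)) _ x

/-- **`G_{S_ω}` is NOT Galois-countable** (failure of [IUTchI] Rmk. 2.5.3 (i) (T2) for the covering
semi-graph of anabelioids of the connected tempered covering `S_ω` of the Thm-3.7-grade, Galois-countable
— but incoherent — `𝒢_ω`).  DIAGONAL ARGUMENT: given a countable family `F_i` of finite objects of
`B^cov(G_{S_ω})` with nonempty fibres, pick at the vertex `vtx i` a point `z_i` of `F_i`; its stabiliser is
open in `P_ω`, so contains all `δ_m` off a finite set — in particular some `δ_{m_i + 1}`; the diagonal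
covering reading the coordinate `m_i + 1` at `vtx i` is split by no `F_i`, since `δ_{m_i+1}` fixes `z_i` but
acts non-trivially (`χ_{m_i+1}(δ_{m_i+1}) ≠ 1`) on the fibre `ℤ/p` over `vtx i`.
[cite: Mochizuki2012, IUTchI Rmk 2.5.3 (i) (T2), p. 52] -/
theorem not_isGaloisCountable_coveringGraph_seqUnwinding :
    ¬ (seqUnwinding p).coveringGraph.IsGaloisCountable := by
  rintro ⟨-, F, hF, hsplit⟩
  -- at the vertex `vtx i`: a point of `F i` and a coordinate `m + 1` whose `δ` stabilises it
  have key : ∀ i : ℕ, ∃ (m : ℕ) (z : ((F i).SV (vtx p i)).obj.V),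
      ((F i).SV (vtx p i)).obj.ρ ⟨IwSeq.single (m + 1), mem_Gv p (vtx p i) _⟩ z = z := by
    intro i
    obtain ⟨z⟩ := (hF i).2.nonempty_V (vtx p i)
    have hopen : IsOpen {k : (seqUnwinding p).coveringGraph.Gv (vtx p i) |
        ((F i).SV (vtx p i)).obj.ρ k z = z} := ((F i).SV (vtx p i)).property.2 z
    obtain ⟨U, hU, hUeq⟩ := isOpen_induced_iff.mp hopen
    have h1 : U ∈ 𝓝 (1 : IwSeq p) := by
      refine hU.mem_nhds ?_
      have : (1 : (seqUnwinding p).coveringGraph.Gv (vtx p i)) ∈ Subtype.val ⁻¹' U := by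
        rw [hUeq]; exact ρ_one_apply _ z
      exact this
    obtain ⟨I, hI⟩ := IwSeq.exists_single_mem_of_mem_nhds h1
    obtain ⟨m, hm⟩ := Infinite.exists_notMem_finset (I.image (· - 1))
    refine ⟨m, z, ?_⟩
    have hmI : m + 1 ∉ I := fun h => hm (Finset.mem_image.mpr ⟨m + 1, h, rfl⟩)
    have : (⟨IwSeq.single (m + 1), mem_Gv p (vtx p i) _⟩ : (seqUnwinding p).coveringGraph.Gv (vtx p i)) ∈
        Subtype.val ⁻¹' U := hI _ hmI
    rw [hUeq] at this
    exact this
  choose m z hz using key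
  -- the diagonal covering reading the coordinate `m i + 1` at `vtx i`
  obtain ⟨i, hiV, -⟩ :=
    hsplit (diagObj p fun v' => m (Quot.out v'.2).natAbs) (diagObj_isFinite p _)
  have h := hiV (vtx p i) (z i) ⟨IwSeq.single (m i + 1), mem_Gv p (vtx p i) _⟩ (hz i)
    (1 : Multiplicative (ZMod p))
  rw [diagObj_ρ, mul_one, out_vtx, Int.natAbs_natCast] at h
  exact IwSeq.χ_single_self (m i + 1) h

/-! ### 3. Records: the heredity of (T2) / of Prop. 3.6's hypotheses needs coherence even over
Thm-3.7-grade bases -/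

/-- **The countermodel, packaged**: a semi-graph of anabelioids satisfying ALL the hypotheses of Thm. 3.7
(NOT coherent) and a connected tempered covering of it of infinite degree whose covering semi-graph of
anabelioids is not Galois-countable. FRONTIER / tightness datum. [cite: Mochizuki2012, IUTchI Rmk 2.5.3 (i) (T2), p. 52] -/
theorem exists_thm37Hypotheses_not_isGaloisCountable_coveringGraph :
    ∃ (𝒢 : ProfiniteSemiGraph.{0}) (S : CovObj 𝒢) (hS : S.IsTempered),
      𝒢.Thm37Hypotheses ∧ Cor39Hypotheses 𝒢 ∧ ¬ 𝒢.IsCoherent ∧ ¬ S.IsFinite ∧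
        IsConnectedObj (⟨S, hS⟩ : BTempCat 𝒢) ∧ ¬ S.coveringGraph.IsGaloisCountable :=
  haveI : Fact (Nat.Prime 2) := ⟨Nat.prime_two⟩
  ⟨seqLoop 2, seqUnwinding 2, seqUnwinding_isTempered 2, seqLoop_thm37Hypotheses 2,
    seqLoop_cor39Hypotheses 2, seqLoop_not_isCoherent 2, seqUnwinding_not_isFinite 2,
    isConnectedObj_seqUnwinding 2, not_isGaloisCountable_coveringGraph_seqUnwinding 2⟩

/-- **Galois-countability (T2) is NOT hereditary along connected tempered coverings of Thm-3.7-grade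
bases**: the universally quantified heredity statement «`Thm37Hypotheses 𝒢` ⇒ `G_S` Galois-countable for
every connected tempered `S`» is FALSE — the hypothesis `IsCoherent` of
`CovObj.isGaloisCountable_coveringGraph_of_isCoherent` (`CoveringGraphCoherent`) cannot be traded for the
remaining hypotheses of Prop. 3.6 / Thm. 3.7 in infinite degree. FRONTIER / tightness datum.
[cite: Mochizuki2012, IUTchI Rmk 2.5.3 (i) (T2), p. 52] -/
theorem not_forall_thm37Hypotheses_isGaloisCountable_coveringGraph :
    ¬ ∀ (𝒢 : ProfiniteSemiGraph.{0}) (S : CovObj 𝒢) (hS : S.IsTempered), 𝒢.Thm37Hypotheses →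
        IsConnectedObj (⟨S, hS⟩ : BTempCat 𝒢) → S.coveringGraph.IsGaloisCountable := fun h =>
  haveI : Fact (Nat.Prime 2) := ⟨Nat.prime_two⟩
  not_isGaloisCountable_coveringGraph_seqUnwinding 2 (h (seqLoop 2) (seqUnwinding 2)
    (seqUnwinding_isTempered 2) (seqLoop_thm37Hypotheses 2) (isConnectedObj_seqUnwinding 2))

/-- **The hypothesis bundle of Prop. 3.6 is NOT hereditary in infinite degree without coherence**: it is
false that `G_S` satisfies `Prop36Hypotheses` whenever `𝒢` satisfies even `Thm37Hypotheses` and `S` is a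
connected tempered covering (its (T2)-clause fails at `(𝒢_ω, S_ω)`) — contrast `CoveringGraphCoherent`
(coherent base: hereditary in every degree) and `CoveringGraphFiniteDegree` (any base: hereditary in finite
degree). FRONTIER / tightness datum. [cite: MochizukiSemiAnbd2006, Prop 3.6 p.38] -/
theorem not_forall_thm37Hypotheses_prop36Hypotheses_coveringGraph :
    ¬ ∀ (𝒢 : ProfiniteSemiGraph.{0}) (S : CovObj 𝒢) (hS : S.IsTempered), 𝒢.Thm37Hypotheses →
        IsConnectedObj (⟨S, hS⟩ : BTempCat 𝒢) → S.coveringGraph.Prop36Hypotheses := fun h =>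
  not_forall_thm37Hypotheses_isGaloisCountable_coveringGraph fun 𝒢 S hS h37 hSc =>
    (h 𝒢 S hS h37 hSc).isGaloisCountable

end IwSeqWitness

end Literature.AnabelianGeometry.SemiGraphs

end
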